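import Literature.NumberTheory.LFunctions.WeilFirstPrimeCertificateDataCCells
import Literature.NumberTheory.LFunctions.WeilFirstPrimeCertificateDataCNu
import Literature.NumberTheory.LFunctions.WeilFirstPrimeCertificateDataCCEven
import Literature.NumberTheory.LFunctions.WeilFirstPrimeCertificateDataCDEven
import Literature.NumberTheory.LFunctions.WeilFirstPrimeCertificateDataCUEven
import Literature.NumberTheory.LFunctions.WeilFirstPrimeCertificateDataCCOdd
import Literature.NumberTheory.LFunctions.WeilFirstPrimeCertificateDataCDOdd
import Literature.NumberTheory.LFunctions.WeilFirstPrimeCertificateDataCUOdd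
import HarnessLib

/-!
# First-prime Weil positivity, stage C (`a₀ = b ≥ (log 3)/2`): the certificate

The Stage-C certificate `Literature.NumberTheory.LFunctions.weilCert3C : WeilCert3` (parameters
`a₀ = b = 563/1024` (`≥ logThreeHiQ/2 ≥ (log 3)/2`), `N = 99`, `T = 50`, dyadic exponent
`j = 5`, `pnu = 64`, `145` integer-checked cells of the signed minorant of
`w₂(t) = Re ψ(1/4+it/2) − √2 log 2 cos(t log 2)`, Legendre blocks `C`, exact inverses `D`, dyadic PSD
factors `U`, and the rounded scaled moment table — all in the imported data modules). Generated by exact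
arithmetic mirroring the checker (`λ_min(S'_even) ≈ 3.762e-08`, `λ_min(S'_odd) ≈ 3.035e-05`
in floating point; exact dominance verified); nothing about the data is trusted — the soundness theorem
`WeilCert3.weilFirstPrimeQuadratic_nonneg_of_check` consumes only `weilCert3C.check = true`, evaluated by the
kernel in the sibling proof files.
-/

noncomputable section

namespace Literature.NumberTheory.LFunctions

/-- **The certificate** (stage C). [folklore] -/
def weilCert3C : WeilCert3 where
  base := ⟨563/1024, 99, 50, 1230683909815/549755813888, 2500, 72, 128, [],
    weilCert3CCEven, weilCert3CCOdd, weilCert3CDEven, weilCert3CDOdd, weilCert3CUEven, weilCert3CUOdd⟩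
  j := 5
  pnu := 64
  cells := weilCert3CCells
  b := 563/1024
  nuData := weilCert3CNuData

end Literature.NumberTheory.LFunctions
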